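import Summits.BirchSwinnertonDyer.BirchSwinnertonDyer.Theorems.GoldfeldAllTwistsTwoConverseTwinGenusOddMultiple
import HarnessLib

set_option linter.dupNamespace false
set_option autoImplicit false

/-!
# LINE B49, genus assembly, family F2 (`d_K = −8q`): the GENUS DESCENT at the point `(−2, y₀)` — the three
# non-squares `−7, 7, −1 ∉ H₀²` of the genus field `H₀ = K(√−2)` and «`y ∉ 2X₀(49)(H₀) + tors`» from an odd
# multiple relation `μ•y_χ ≡ λ•(−2, y₀)`, `λ` odd (the F2 analogue of gen 6's `…TwinGenusOddMultiple` §§1–2)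

Cell `bsd-goldfeld`, seat `bsd-goldfeld-s1p-c3` (prover, gen 8); memo `HOME/B49-GENUS.md` §3 (Lemma S for family F2:
`x(g′) = −2`, `δ(g′) = x − 2 = −4 ≡ −1`), the F2 analogue of `…TwinGenusOddMultiple` (family F1, point `(0, i)`,
`δ = −2`) and of `…TwinGenusDescentSquares` §3. Support for item `stmt-BirchSwinnertonDyer-19140` (crux twin″;
joint with 20044 K12₂″). Theorems only. HONEST FRAMING: BSD is not proved by any of this; elementary `2`-descent and
field arithmetic; no `L`-value, no named fact.

CONTENTS.
* §1 `not_isSquare_genusField_negTwo`: in a quadratic extension `H₀ = K(θ₀)`, `θ₀² = −2`, of `K = ℚ(√−2q)`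
  (`d_K = −8q`, `q` prime, `q ≠ 2, 7`), none of `−7, 7, −1` is a square (reduction `H₀ → K → ℚ` by gen 6's
  `isSquare_or_isSquare_mul_of_isSquare_algebraMap` / `isSquare_or_of_isSquare_algebraMap_rat`, then the rational
  constants `c`, `−8qc`, `−2c`, `16qc` for `c ∈ {−7, 7, −1}`).
* §2 `cm7_ne_two_zsmul_add_of_oddMultiple_negTwo`: over a field `F` with `−7, 7, −1 ∉ F²`, if `(−2, y₀) ∈ X₀(49)(F)`,
  `y − y' − 2•Z ∈ tors` and `μ•y' − λ•(−2, y₀) ∈ tors` with `λ` odd, then `y ∉ 2X₀(49)(F) + X₀(49)(F)_tors` (gen 6's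
  normal-form descent `ne_two_zsmul_add_of_oddMultiple`: on `y² = x³ + 21x² + 112x` the point has `x = −16`, class
  `[−1]`, and `[−1]·[112] = [−7]`); odd rescaling; infinite order; and the versions with the F2 genus data in hand
  (`…_of_genusData_negEight`): for `K` with `d_K = −8q` and `H₀/K` quadratic containing `θ₀`.

References: J. H. Silverman, J. T. Tate, *Rational Points on Elliptic Curves* (2015) §3.5 [SilvermanTate2015];
Y. Tian, Camb. J. Math. 2 (2014) §1 (1.3) [Tian2014]; B. Gross, in *Modular forms* (1984) §§4–5 [Gross1984].
-/

noncomputable section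

open scoped Classical

open WeierstrassCurve Literature.NumberTheory.EllipticCurves Literature.NumberTheory.GaloisRepresentations
  Literature.NumberTheory.EllipticCurves.ModularForms

namespace Summit.BirchSwinnertonDyer.BirchSwinnertonDyer.Theorems.GoldfeldGoodTwists

/-! ## §1 The genus field `H₀ = K(√−2)` of `K = ℚ(√−2q)`: the three non-squares -/

section GenusFieldNegTwo

variable {K : Type} [Field K] [NumberField K]

/-- A rational constant that becomes a square in the quadratic extension `H₀ = K(θ₀)`, `θ₀² = −2`, of
`K = ℚ(√−2q)` (`d_K = −8q`, `q` prime) is a square in `K` or `−2` times it is. (`θ₀ ∉ K`: else `−2` or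
`−2·d_K = 16q` would be a rational square.) [folklore] -/
theorem isSquare_or_of_isSquare_algebraMap_genusField_negTwo (hK : IsImaginaryQuadratic K) {q : ℕ}
    (hq : q.Prime) (hdK : NumberField.discr K = -(8 * (q : ℤ)))
    {H₀ : Type*} [Field H₀] [Algebra K H₀] (hH : Module.finrank K H₀ = 2) {θ₀ : H₀}
    (hi : θ₀ ^ 2 = -2) {c : K} (hc : IsSquare (algebraMap K H₀ c)) : IsSquare c ∨ IsSquare (c * -2) := by
  have hiK : ∀ a : K, algebraMap K H₀ a ≠ θ₀ := by
    intro a ha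
    have h1 : IsSquare (algebraMap ℚ K (-2)) := by
      refine ⟨a, ?_⟩
      apply (algebraMap K H₀).injective
      rw [map_mul, ha, ← pow_two, hi, map_neg, map_ofNat, map_neg, map_ofNat]
    rcases isSquare_or_of_isSquare_algebraMap_rat hK h1 with h | h
    · exact not_isSquare_of_neg (by norm_num) h
    · rw [hdK] at h
      push_cast at h
      have h' : IsSquare (q : ℚ) :=
        isSquare_of_isSquare_four_mul (isSquare_of_isSquare_four_mul (by convert h using 1; ring))
      exact not_isSquare_prime hq (Rat.isSquare_natCast_iff.mp h')
  have hi' : θ₀ ^ 2 = algebraMap K H₀ (-2) := by rw [hi, map_neg, map_ofNat]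
  have h2 : (2 : K) ≠ 0 := two_ne_zero
  exact isSquare_or_isSquare_mul_of_isSquare_algebraMap h2 hi' hiK (exists_eq_add_mul_of_finrank_eq_two hH hiK) hc

/-- **The three non-squares of the F2 genus descent**: in `H₀ = K(√−2)`, `K = ℚ(√−2q)` (`d_K = −8q`, `q` prime,
`q ≠ 2, 7`), none of `−7, 7, −1` is a square (the rational constants `c`, `−8q·c`, `−2c`, `16q·c` are non-squares
for `c = −7, 7, −1`: signs, `7 ≠ q`, `2 ≠ q`, `14q`). [folklore] -/
theorem not_isSquare_genusField_negTwo (hK : IsImaginaryQuadratic K) {q : ℕ} (hq : q.Prime) (hq2 : q ≠ 2)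
    (hq7 : q ≠ 7) (hdK : NumberField.discr K = -(8 * (q : ℤ)))
    {H₀ : Type*} [Field H₀] [Algebra K H₀] (hH : Module.finrank K H₀ = 2) {θ₀ : H₀} (hi : θ₀ ^ 2 = -2) :
    ¬ IsSquare (-7 : H₀) ∧ ¬ IsSquare (7 : H₀) ∧ ¬ IsSquare (-1 : H₀) := by
  obtain ⟨⟨-, -⟩, ⟨n7, -⟩, ⟨-, -⟩, ⟨n2, -⟩, ⟨-, -⟩, ⟨n14, -⟩⟩ := not_isSquare_genusConstants hq hq2 hq7
  have hq0 : (0 : ℚ) < q := by exact_mod_cast hq.pos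
  have n7q : ¬ IsSquare ((7 * q : ℕ) : ℚ) := by
    rw [Rat.isSquare_natCast_iff]
    exact QuadraticFamily.not_isSquare_mul_of_prime (by norm_num) hq (Ne.symm hq7)
  have n2q : ¬ IsSquare ((2 * q : ℕ) : ℚ) := by
    rw [Rat.isSquare_natCast_iff]
    exact QuadraticFamily.not_isSquare_mul_of_prime (by norm_num) hq (Ne.symm hq2)
  have n14q : ¬ IsSquare ((14 * q : ℕ) : ℚ) := by
    rw [Rat.isSquare_natCast_iff]; exact not_isSquare_fourteen_mul_prime hq
  have hdQ : ((NumberField.discr K : ℤ) : ℚ) = -(8 * (q : ℚ)) := by rw [hdK]; push_cast; ring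
  -- reduction of a rational constant from `H₀` to `ℚ`
  have red : ∀ c : ℚ, IsSquare (algebraMap K H₀ (algebraMap ℚ K c)) →
      (IsSquare c ∨ IsSquare (c * -(8 * (q : ℚ)))) ∨
        (IsSquare (c * -2) ∨ IsSquare (c * -2 * -(8 * (q : ℚ)))) := by
    intro c hc
    rcases isSquare_or_of_isSquare_algebraMap_genusField_negTwo hK hq hdK hH hi hc with h | h
    · left; rw [← hdQ]; exact isSquare_or_of_isSquare_algebraMap_rat hK h
    · right; rw [← hdQ]
      exact isSquare_or_of_isSquare_algebraMap_rat hK (by rw [map_mul, map_neg, map_ofNat]; exact h)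
  have cast : ∀ c : ℚ, algebraMap K H₀ (algebraMap ℚ K c) = (c : H₀) := fun c => by
    rw [eq_ratCast, map_ratCast]
  refine ⟨fun h => ?_, fun h => ?_, fun h => ?_⟩
  · rcases red (-7) (by rw [cast]; push_cast; exact h) with (h' | h') | (h' | h')
    · exact not_isSquare_of_neg (by norm_num) h'
    · refine n14q ?_
      push_cast; exact isSquare_of_isSquare_four_mul (by convert h' using 1; ring)
    · exact n14 (by convert h' using 1; ring)
    · exact not_isSquare_of_neg (by nlinarith) h'
  · rcases red 7 (by rw [cast]; push_cast; exact h) with (h' | h') | (h' | h')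
    · exact n7 h'
    · exact not_isSquare_of_neg (by nlinarith) h'
    · exact not_isSquare_of_neg (x := 7 * -2) (by norm_num) h'
    · refine n7q ?_
      push_cast
      exact isSquare_of_isSquare_four_mul (isSquare_of_isSquare_four_mul (by convert h' using 1; ring))
  · rcases red (-1) (by rw [cast]; push_cast; exact h) with (h' | h') | (h' | h')
    · exact not_isSquare_of_neg (by norm_num) h'
    · refine n2q ?_
      push_cast; exact isSquare_of_isSquare_four_mul (by convert h' using 1; ring)
    · exact n2 (by convert h' using 1; ring)
    · exact not_isSquare_of_neg (by nlinarith) h'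

end GenusFieldNegTwo

/-! ## §2 The descent at the point `(−2, y₀)` (class `[−1]` on the normal form) -/

section DescentNegTwo

variable {F : Type*} [Field F] [CharZero F]

/-- **The F2 genus descent on `X₀(49)` over a field `F`** in which `−7, 7, −1` are not squares (e.g. the genus
field `ℚ(√−2q, √−2)`): let `g = (−2, y₀) ∈ X₀(49)(F)`, and let `y, y', Z ∈ X₀(49)(F)`, `μ, λ ∈ ℤ` with `λ` odd satisfy
`y − y' − 2•Z ∈ tors` and `μ•y' − λ•g ∈ tors`. Then `y ≠ 2•R + t` for every `R ∈ X₀(49)(F)` and torsion `t`. On the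
normal form `y² = x³ + 21x² + 112x` (`cm7NFChange`: `a² − 4b = −7`, `b = 112 = 4²·7`) the point `g` has `x = −16`,
class `α(g) = [−1]`, `α(g)·[b] = [−7]`; gen 6's `ne_two_zsmul_add_of_oddMultiple` concludes.
[cite: SilvermanTate2015, §3.5] [cite: Tian2014, §1 (1.3)] -/
theorem cm7_ne_two_zsmul_add_of_oddMultiple_negTwo (h7 : ¬ IsSquare (-7 : F)) (h7' : ¬ IsSquare (7 : F))
    (h1 : ¬ IsSquare (-1 : F)) {y₀ : F} (hg : (cm7.baseChange F).toAffine.Nonsingular (-2) y₀)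
    {y y' Z : (cm7.baseChange F).toAffine.Point} {μ l : ℤ} (hl : Odd l)
    (hG : IsOfFinAddOrder (y - y' - (2 : ℤ) • Z))
    (hA : IsOfFinAddOrder (μ • y' - l • Affine.Point.some (-2) y₀ hg))
    (R t : (cm7.baseChange F).toAffine.Point) (ht : IsOfFinAddOrder t) : y ≠ (2 : ℤ) • R + t := by
  set V : WeierstrassCurve F := cm7NFChange F • cm7.baseChange F with hV
  have hVeq : V = ⟨0, 21, 0, 112, 0⟩ := cm7NFChange_smul
  haveI : V.IsTwoTorsionNF := by rw [hVeq]; infer_instance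
  have ha₂ : V.a₂ = 21 := by rw [hVeq]
  have ha₄ : V.a₄ = 112 := by rw [hVeq]
  have hD : ¬ IsSquare (V.a₂ ^ 2 - 4 * V.a₄) := by
    rw [ha₂, ha₄, show ((21 : F) ^ 2 - 4 * 112) = -7 by norm_num]; exact h7
  have hb : ¬ IsSquare V.a₄ := by
    rw [ha₄]; rintro ⟨r, hr⟩; exact h7' ⟨r / 4, by linear_combination hr / 16⟩
  let e : (cm7.baseChange F).toAffine.Point ≃+ V.toAffine.Point :=
    VariableChange.pointEquiv (cm7.baseChange F) (cm7NFChange F)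
  -- the image of `g = (−2, y₀)` has `x = −16`
  have hx : (cm7NFChange F).toX (-2) = -16 := by
    simp [VariableChange.toX_def, cm7NFChange]; norm_num
  have hg' := (VariableChange.nonsingular_iff (cm7.baseChange F) (cm7NFChange F) (-2) y₀).mpr hg
  have heg : e (.some (-2) y₀ hg) = .some ((cm7NFChange F).toX (-2)) ((cm7NFChange F).toY (-2) y₀) hg' :=
    VariableChange.pointEquiv_some _ _ hg
  have hx0 : (cm7NFChange F).toX (-2) ≠ 0 := by rw [hx]; norm_num
  have hsq1 : ¬ IsSquare ((cm7NFChange F).toX (-2)) := by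
    rw [hx]; rintro ⟨r, hr⟩; exact h1 ⟨r / 4, by linear_combination hr / 16⟩
  have hsq2 : ¬ IsSquare ((cm7NFChange F).toX (-2) * V.a₄) := by
    rw [hx, ha₄]; rintro ⟨r, hr⟩; exact h7 ⟨r / 16, by linear_combination hr / 256⟩
  obtain ⟨hg₁, hg₂⟩ := V.xSqClass_ne_one_and_ne_of_not_isSquare hg' hx0 hsq1 hsq2
  rw [← heg] at hg₁ hg₂
  -- transport the hypotheses along `e`
  have hG' : IsOfFinAddOrder (e y - e y' - (2 : ℤ) • e Z) := by
    have := e.toAddMonoidHom.isOfFinAddOrder hG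
    simpa [map_sub, map_zsmul] using this
  have hA' : IsOfFinAddOrder (μ • e y' - l • e (.some (-2) y₀ hg)) := by
    have := e.toAddMonoidHom.isOfFinAddOrder hA
    simpa [map_sub, map_zsmul] using this
  have ht' : IsOfFinAddOrder (e t) := e.toAddMonoidHom.isOfFinAddOrder ht
  intro hy
  refine V.ne_two_zsmul_add_of_oddMultiple hD hb hl hG' hA' hg₁ hg₂ (e R) (e t) ht' ?_
  rw [hy, map_add, map_zsmul]

/-- **Corollary (odd rescaling): `k • y ∉ 2X₀(49)(F) + tors` for every ODD `k`** under the same hypotheses.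
[cite: SilvermanTate2015, §3.5] -/
theorem cm7_odd_zsmul_ne_two_zsmul_add_of_oddMultiple_negTwo (h7 : ¬ IsSquare (-7 : F))
    (h7' : ¬ IsSquare (7 : F)) (h1 : ¬ IsSquare (-1 : F)) {y₀ : F}
    (hg : (cm7.baseChange F).toAffine.Nonsingular (-2) y₀)
    {y y' Z : (cm7.baseChange F).toAffine.Point} {μ l : ℤ} (hl : Odd l)
    (hG : IsOfFinAddOrder (y - y' - (2 : ℤ) • Z))
    (hA : IsOfFinAddOrder (μ • y' - l • Affine.Point.some (-2) y₀ hg)) {k : ℤ} (hk : Odd k)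
    (R t : (cm7.baseChange F).toAffine.Point) (ht : IsOfFinAddOrder t) :
    k • y ≠ (2 : ℤ) • R + t := by
  have e1 : k • y - k • y' - (2 : ℤ) • (k • Z) = k • (y - y' - (2 : ℤ) • Z) := by module
  have e2 : μ • (k • y') - (k * l) • Affine.Point.some (-2) y₀ hg =
      k • (μ • y' - l • Affine.Point.some (-2) y₀ hg) := by module
  refine cm7_ne_two_zsmul_add_of_oddMultiple_negTwo h7 h7' h1 hg (y' := k • y') (Z := k • Z) (μ := μ)
    (hk.mul hl) ?_ ?_ R t ht
  · rw [e1]; exact isOfFinAddOrder_zsmul k hG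
  · rw [e2]; exact isOfFinAddOrder_zsmul k hA

/-- **Corollary: `y` has infinite order** under the hypotheses of `cm7_ne_two_zsmul_add_of_oddMultiple_negTwo`.
[cite: SilvermanTate2015, §3.5] [cite: Tian2014, §1 (1.3)] -/
theorem cm7_not_isOfFinAddOrder_of_oddMultiple_negTwo (h7 : ¬ IsSquare (-7 : F)) (h7' : ¬ IsSquare (7 : F))
    (h1 : ¬ IsSquare (-1 : F)) {y₀ : F} (hg : (cm7.baseChange F).toAffine.Nonsingular (-2) y₀)
    {y y' Z : (cm7.baseChange F).toAffine.Point} {μ l : ℤ} (hl : Odd l)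
    (hG : IsOfFinAddOrder (y - y' - (2 : ℤ) • Z))
    (hA : IsOfFinAddOrder (μ • y' - l • Affine.Point.some (-2) y₀ hg)) : ¬ IsOfFinAddOrder y := fun hy ↦
  cm7_odd_zsmul_ne_two_zsmul_add_of_oddMultiple_negTwo h7 h7' h1 hg hl hG hA odd_one 0 y hy
    (by rw [one_zsmul, smul_zero, zero_add])

variable {K : Type} [Field K] [NumberField K]

/-- **The F2 genus descent with the data in hand**: for `K` imaginary quadratic with `d_K = −8q` (`q` prime,
`(q/7) = −1`), a quadratic extension `H₀/K` containing `θ₀` with `θ₀² = −2` and a point `(−2, y₀) ∈ X₀(49)(H₀)`,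
points `y, y', Z ∈ X₀(49)(H₀)` and `μ, λ ∈ ℤ`, `λ` odd, with `y − y' − 2•Z` and `μ•y' − λ•(−2, y₀)` torsion:
`k • y ∉ 2X₀(49)(H₀) + X₀(49)(H₀)_tors` for every ODD `k`; in particular `y` has infinite order.
[cite: Gross1984, §§4–5] [cite: Tian2014, §1 (1.3)] [cite: SilvermanTate2015, §3.5] -/
theorem cm7_odd_zsmul_ne_two_zsmul_add_of_genusData_negEight (hK : IsImaginaryQuadratic K) {q : ℕ}
    (hq : q.Prime) (hq7 : jacobiSym q 7 = -1) (hdK : NumberField.discr K = -(8 * (q : ℤ)))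
    {H₀ : Type*} [Field H₀] [CharZero H₀] [Algebra K H₀] (hH : Module.finrank K H₀ = 2) {θ₀ : H₀}
    (hi : θ₀ ^ 2 = -2) {y₀ : H₀} (hg : (cm7.baseChange H₀).toAffine.Nonsingular (-2) y₀)
    {y y' Z : (cm7.baseChange H₀).toAffine.Point} {μ l : ℤ} (hl : Odd l)
    (hG : IsOfFinAddOrder (y - y' - (2 : ℤ) • Z))
    (hA : IsOfFinAddOrder (μ • y' - l • Affine.Point.some (-2) y₀ hg)) {k : ℤ} (hk : Odd k)
    (R t : (cm7.baseChange H₀).toAffine.Point) (ht : IsOfFinAddOrder t) : k • y ≠ (2 : ℤ) • R + t := by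
  obtain ⟨hq2, hq7'⟩ := ne_two_and_ne_seven_of_jacobiSym hq7
  obtain ⟨h7, h7', h1⟩ := not_isSquare_genusField_negTwo hK hq hq2 hq7' hdK hH hi
  exact cm7_odd_zsmul_ne_two_zsmul_add_of_oddMultiple_negTwo h7 h7' h1 hg hl hG hA hk R t ht

/-- **B49₈ clause (i) at a datum, from the F2 genus data**: with the data of
`cm7_odd_zsmul_ne_two_zsmul_add_of_genusData_negEight` and a point `P ∈ X₀(49)(K)` with `P ↦ n • y` in `X₀(49)(H₀)`,
`n ≠ 0`: `P` has infinite order. (The shape of gen 6's `not_isOfFinAddOrder_heegnerPoint_of_genusOddMultiple` for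
`d_K = −8q`; the data are produced from Theorem A′ by the conductor-one witness plumbing.)
[cite: Gross1984, §§4–5] [cite: Tian2014, §1 (1.3)] -/
theorem not_isOfFinAddOrder_of_genusData_negEight (hK : IsImaginaryQuadratic K) {q : ℕ}
    (hq : q.Prime) (hq7 : jacobiSym q 7 = -1) (hdK : NumberField.discr K = -(8 * (q : ℤ)))
    {H₀ : Type*} [Field H₀] [CharZero H₀] [Algebra K H₀] (hH : Module.finrank K H₀ = 2) {θ₀ : H₀}
    (hi : θ₀ ^ 2 = -2) {y₀ : H₀} (hg : (cm7.baseChange H₀).toAffine.Nonsingular (-2) y₀)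
    {P : (cm7.baseChange K).toAffine.Point} {y y' Z : (cm7.baseChange H₀).toAffine.Point} {n μ l : ℤ}
    (hn : n ≠ 0) (hl : Odd l) (hPy : Affine.Point.map (algebraMap K H₀).toRatAlgHom P = n • y)
    (hG : IsOfFinAddOrder (y - y' - (2 : ℤ) • Z))
    (hA : IsOfFinAddOrder (μ • y' - l • Affine.Point.some (-2) y₀ hg)) : ¬ IsOfFinAddOrder P := by
  intro hPt
  have hy : IsOfFinAddOrder y := by
    have h1 := (Affine.Point.map (W' := cm7) (algebraMap K H₀).toRatAlgHom).isOfFinAddOrder hPt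
    rw [hPy] at h1
    exact Literature.NumberTheory.EllipticCurves.isOfFinAddOrder_of_zsmul hn h1
  exact cm7_odd_zsmul_ne_two_zsmul_add_of_genusData_negEight hK hq hq7 hdK hH hi hg hl hG hA odd_one 0 y hy
    (by rw [one_zsmul, smul_zero, zero_add])

end DescentNegTwo

end Summit.BirchSwinnertonDyer.BirchSwinnertonDyer.Theorems.GoldfeldGoodTwists

end
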